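import Summits.QuantumFields.QCD.Theses.MultibosonBridge
import HarnessLib

/-!
# `StableChiralityTransfers` (stmt-QuantumFields-17621, route MultibosonBridge, support) — proved

SUBSEQUENCE STABILITY OF THE CHIRAL CLAUSE: if `reg'` is the subsequence `φ` of the regularisation `reg` (same `a, β, L,
m_crit, Z_m` composed with a strictly increasing `φ`), then the subsequence-stable chiral clause of `reg` — for every
`ε > 0` a positive mass tuple `m`, one pair of local observables and, for EVERY constant `C`, eventually in `k` a torus
`S ≥ L_k` and a time `n ≤ S` at which the connected correlator beats `C·e^{−ε a_k n}` — transfers to `reg'` (the clause is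
an `∀ᶠ k` statement and `φ → ∞`, `Filter.Tendsto.eventually`), and implies `reg'.IsChiralAtZero` (instantiate the clause at
the gap's own constant `C`; the two eventual statements meet at one `k`).  Pure bookkeeping on the definitions
`QCDRegularisation.scheme`, `QCDScheme.HasLatticeMassGap`, `QCDRegularisation.IsChiralAtZero`; a refuter's candidate proof of
the same shape is attached to the item (2026-08-28T21:55Z).  Width seat ym-line-sfw-p2-w2 g24 (cell ym-idea-1; free hands).
HONEST FRAMING: support item only; no crux, rung or summit is proved; nothing here bears on the Yang–Mills mass gap. [folklore]
-/

set_option autoImplicit false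

namespace Summit.QuantumFields.QCD.Theorems.MultibosonBridgeStableChiralityTransfers

open Filter Literature.MathematicalPhysics.QuantumFieldTheory

/-- **`StableChiralityTransfers`** (stmt-QuantumFields-17621). [folklore] -/
theorem stableChiralityTransfers_proof :
    Summit.QuantumFields.QCD.Theses.MultibosonBridge.StableChiralityTransfers := by
  intro Nf reg reg' φ hφ ha hβ hL hmc hZ H
  have hφt : Tendsto φ atTop atTop := hφ.tendsto_atTop
  -- the fields of `reg'.scheme m 0 0` are those of `reg.scheme m 0 0` along `φ`
  have eL : ∀ (m : Fin Nf → ℝ) (k : ℕ), (reg'.scheme m 0 0).L k = (reg.scheme m 0 0).L (φ k) := fun m k => by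
    show reg'.L k = reg.L (φ k)
    rw [hL]; rfl
  have ea : ∀ (m : Fin Nf → ℝ) (k : ℕ), (reg'.scheme m 0 0).a k = (reg.scheme m 0 0).a (φ k) := fun m k => by
    show reg'.a k = reg.a (φ k)
    rw [ha]; rfl
  have eβ : ∀ (m : Fin Nf → ℝ) (k : ℕ), (reg'.scheme m 0 0).β k = (reg.scheme m 0 0).β (φ k) := fun m k => by
    show reg'.β k = reg.β (φ k)
    rw [hβ]; rfl
  have emq : ∀ (m : Fin Nf → ℝ) (fl : Fin Nf) (k : ℕ),
      (reg'.scheme m 0 0).mq fl k = (reg.scheme m 0 0).mq fl (φ k) := fun m fl k => by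
    simp only [QCDRegularisation.scheme_mq]
    rw [hmc, ha, hZ]
    rfl
  -- (1) the clause transfers along `φ`
  have H' : ∀ ε : ℝ, 0 < ε → ∃ m : Fin Nf → ℝ, (∀ f, 0 < m f) ∧ ∃ (R R' : ℕ) (A : QCDLatticeObservable Nf R)
      (B : QCDLatticeObservable Nf R'), ∀ C : ℝ, ∀ᶠ k in atTop, ∃ S : ℕ, (reg'.scheme m 0 0).L k ≤ S ∧ ∃ n : ℕ,
        n ≤ S ∧ C * Real.exp (-(ε * ((reg'.scheme m 0 0).a k * n))) <
          ‖qcdLatticeConnectedCorr ((reg'.scheme m 0 0).β k) (2 * S + 1) (fun fl => (reg'.scheme m 0 0).mq fl k)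
            A B n‖ := by
    intro ε hε
    obtain ⟨m, hm, R, R', A, B, hC⟩ := H ε hε
    refine ⟨m, hm, R, R', A, B, fun C => ?_⟩
    refine (hφt.eventually (hC C)).mono fun k hk => ?_
    obtain ⟨S, hS, n, hn, hlt⟩ := hk
    refine ⟨S, ?_, n, hn, ?_⟩
    · rw [eL]; exact hS
    · rw [ea, eβ]
      simp only [emq]
      exact hlt
  refine ⟨H', ?_⟩
  -- (2) the clause at the gap's own constant contradicts a uniform gap
  intro ε hε
  obtain ⟨m, hm, R, R', A, B, hC⟩ := H' ε hε
  refine ⟨m, hm, fun hgap => ?_⟩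
  obtain ⟨C, hCk⟩ := hgap R R' A B
  obtain ⟨k, h1, h2⟩ := ((hC C).and hCk).exists
  obtain ⟨S, hS, n, hn, hlt⟩ := h1
  exact absurd (h2 S hS n hn) (not_le.2 hlt)

end Summit.QuantumFields.QCD.Theorems.MultibosonBridgeStableChiralityTransfers

/-- **`MultibosonBridge.StableChiralityTransfers` holds** (stmt-QuantumFields-17621), route-level name. [folklore] -/
theorem Summit.QuantumFields.QCD.Theorems.multibosonBridge_stableChiralityTransfers_proof :
    Summit.QuantumFields.QCD.Theses.MultibosonBridge.StableChiralityTransfers :=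
  Summit.QuantumFields.QCD.Theorems.MultibosonBridgeStableChiralityTransfers.stableChiralityTransfers_proof
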